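import Summits.BirchSwinnertonDyer.Rank1Residual.X11b.LevelShiftMaps
import Literature.NumberTheory.EllipticCurves.KummerSequenceConnecting
import Literature.NumberTheory.EllipticCurves.PointDivisibilityProofs
import HarnessLib

/-!
# Levels in local Galois cohomology: `#H¹(E, E[p^{j+1}])[p] ≤ #H¹(E, E[p])` when `E[p](K̄)^{Γ_E} = 0`
# (cell `b2b-bsdres`, CLASS-CLOSURE lane, class O10 — x1b GEN 41, class lead; file 97 of the series)

HONEST FRAMING (cell `b2b-bsdres`, run/shared/lean/b2b/bsd-rank1-residual/, verbatim in every
file): the goal of the cell is to DELETE the COMBINATION-SHAPED residual classes of the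
Birch–Swinnerton-Dyer formula for ALL analytic-rank `≤ 1` elliptic curves over `ℚ` — "full BSD
formula for every rank `≤ 1` curve in class `C`" assembled STRICTLY from published theorems — so
that the rank-`≤ 1` remainder becomes exactly the CONSTRUCTION-SHAPED classes, which are TYPED
(missing-input `Prop`s), NOT attempted. This is not "finishing BSD". CLASS-CLOSURE lane: prove
what is provable now; shrink each hard class to its core with data; no claim beyond stated classes;
research routes on CONSTRUCTION-SHAPED X12 / O10; census / instrument output = EVIDENCE / conjecture
items, NEVER a Literature fact; `RESIDUAL-MAP.md` marks change only by signed lines. THIS FILE: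
TOOL THEOREMS ONLY — no definition, no named Literature fact, no `sorry`, axioms standard; nothing
is booked; no label / mark / count / sub-cell moves; (C1_η), (C2_η-GZ), (C3_η) stay typed as filed
(cc-typer-6's pen); nothing about `BSD(W, p)` of any pair is claimed.

## What (generic: any field `K` of characteristic `0`, `W/K` elliptic, any `K`-field `E`, prime `p`)

The numerical hypothesis `hHp : #H¹(ℚ_p, W[p^m])[p] ≤ p²` of files 94–96 (B3 in level-`m` shape)
reduces to the level-`p` count `#H¹(ℚ_p, W[p])` by a LEVEL argument, carried out here in the
tree's currency `galoisCohomology (GaloisRep.restrictField E (W.torsionGaloisModule (p^k))) 1`: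

* `isSES_torsionInclusion_levelMul` — **`0 → E[p] →(ι) E[p^{j+1}] →(p·) E[p^j] → 0` is a short
  exact sequence of discrete `Γ_K`-modules** (the tree's `torsionInclusion`, X11b's
  `Levels.levelMul W p j 1`; surjectivity = divisibility of `E(K̄)`);
* `nsmul_eq_map_levelIncl_map_levelMul` — multiplication by `p` on `H¹(E, E[p^{j+1}])` factors as
  `H¹(ι') ∘ H¹(π)` through `H¹(E, E[p^j])` (`ι' : E[p^j] ↪ E[p^{j+1}]` = X11b `Levels.levelIncl`);
* `map_levelIncl_injective_of_invariants` — `H¹(ι')` is INJECTIVE when `E[p](K̄)^{Γ_E} = 0`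
  (if `ι' ∘ ψ = ∂T`, `T ∈ E[p^{j+1}]`, then `p^j T` is a `Γ_E`-fixed point of `E[p]`, so `T ∈ E[p^j]`);
* **`natCard_ker_nsmul_galoisCohomology_le`** — hence **`#H¹(E, E[p^{j+1}])[p] ≤ #H¹(E, E[p])`**:
  the kernel of `p` is killed by `H¹(π)`, so lies in the image of `H¹(E, E[p])` by the exactness
  of `H¹(E, E[p]) → H¹(E, E[p^{j+1}]) → H¹(E, E[p^j])` (the tree's
  `IsSES.exists_map_one_eq_of_map_one_eq_zero`, Serre I §2.2).

Consumer: file 98 `SignedTwistLocalEulerBound` (the count at `E = ℚ_[p]` from Tate's local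
Euler–Poincaré characteristic, and B3 in level-`m` shape modulo the named fact only).

References: [SerreGaloisCohomology1997] I §2.2 (long exact sequence), I §5.1;
[MilneADT2006] Ch. I §6, proof of Prop. 6.9 (`0 → A_m → A_{mn} → A_n → 0`);
[SilvermanAEC2009] VIII.§2.
-/

noncomputable section

open scoped Classical

open WeierstrassCurve Field

namespace Summit.BirchSwinnertonDyer.Rank1Residual.Additive.SignedTwist

open Literature.NumberTheory.EllipticCurves Literature.NumberTheory.GaloisRepresentations
  Summit.BirchSwinnertonDyer.Rank1Residual.X11b
open scoped ContRepresentation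

/-! ## §1 Levels: `#H¹(E, E[p^{j+1}])[p] ≤ #H¹(E, E[p])` when `E[p](K̄)^{Γ_E} = 0` -/

section Levels

variable {K : Type} [Field K] (W : WeierstrassCurve K) (E : Type) [Field E] [Algebra K E] (p j : ℕ)

/-- `p ∣ p^{j+1}` in `ℤ` at the literal prime-power levels (the inclusion `E[p] ⊆ E[p^{j+1}]`).
[folklore] -/
theorem natCast_dvd_natCast_pow_succ : ((p ^ 1 : ℕ) : ℤ) ∣ ((p ^ (j + 1) : ℕ) : ℤ) :=
  Int.natCast_dvd_natCast.mpr (pow_dvd_pow p (Nat.le_add_left 1 j))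

/-- `H¹(id) = id` on `H¹(E, M)` (`[φ] ↦ [id ∘ φ]`). [folklore] -/
theorem map_id_one_apply {M : Type} [AddCommGroup M] [TopologicalSpace M] [DiscreteTopology M]
    (σ : DiscreteGaloisModule E M) (c : galoisCohomology σ 1) :
    galoisCohomology.map (ContIntertwiningMap.id : σ.toContRepresentation →ⁱL σ.toContRepresentation)
      1 c = c := by
  obtain ⟨φ, rfl⟩ := oneCocycleClass_surjective σ.toTopRep c
  rw [galoisCohomology.map_one_oneCocycleClass]
  rfl

/-- **`0 → E[p] →(ι) E[p^{j+1}] →(p·) E[p^j] → 0` is a short exact sequence of discrete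
`Γ_K`-modules** (`ι` the tree's `torsionInclusion`, `p·` = X11b's `Levels.levelMul W p j 1`;
surjectivity = divisibility of `E(K̄)`, `zsmul_geomPoints_surjective_holds`). Milne's
`0 → A_m → A_{mn} →ᵐ A_n → 0`. [cite: MilneADT2006, Ch. I §6, proof of Prop. 6.9]
[cite: SilvermanAEC2009, VIII.§2] -/
theorem isSES_torsionInclusion_levelMul [W.IsElliptic] [Fact p.Prime] :
    IsSES (DiscreteGaloisModule.homOfIntertwining (W.torsionInclusion (natCast_dvd_natCast_pow_succ p j)))
      (DiscreteGaloisModule.homOfIntertwining (Levels.levelMul W p j 1)) where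
  comp_eq_zero := by
    ext P
    have h := (mem_geomTorsion_iff W ((p ^ 1 : ℕ) : ℤ) _).mp P.2
    change ((Levels.levelMul W p j 1 (W.torsionInclusion (natCast_dvd_natCast_pow_succ p j) P) :
      geomTorsion W ((p ^ j : ℕ) : ℤ)) : geomPoints W) = 0
    rw [Levels.coe_levelMul_apply, coe_torsionInclusion_apply]
    exact h
  injective := fun P Q h => Subtype.ext (congrArg Subtype.val h :)
  exact_mid := fun P hP => by
    have hP' : ((p ^ 1 : ℕ) : ℤ) • (P : geomPoints W) = 0 := by
      rw [← Levels.coe_levelMul_apply]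
      exact congrArg Subtype.val hP
    exact ⟨⟨P, (mem_geomTorsion_iff W _ _).mpr hP'⟩, rfl⟩
  surjective := Levels.levelMul_surjective W p j 1 W.zsmul_geomPoints_surjective_holds

/-- **Multiplication by `p` on `H¹(E, E[p^{j+1}])` factors through `H¹(E, E[p^j])`**:
`p • x = ι_* (π_* x)` with `π = [p] : E[p^{j+1}] → E[p^j]` and `ι : E[p^j] ↪ E[p^{j+1}]`
(`ι (π T) = p • T`, X11b `Levels.levelIncl_levelMul`). [cite: SerreGaloisCohomology1997, I §2.2] -/
theorem nsmul_eq_map_levelIncl_map_levelMul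
    (x : galoisCohomology (GaloisRep.restrictField E (W.torsionGaloisModule ((p ^ (j + 1) : ℕ) : ℤ))) 1) :
    p • x = galoisCohomology.map ((Levels.levelIncl W p j 1).restrictField E) 1
      (galoisCohomology.map ((Levels.levelMul W p j 1).restrictField E) 1 x) := by
  have h := Levels.map_map_eq_nsmul_map_of_comp_eq
    (ρ₂ := GaloisRep.restrictField E (W.torsionGaloisModule ((p ^ (j + 1) : ℕ) : ℤ)))
    (ρ₁ := GaloisRep.restrictField E (W.torsionGaloisModule ((p ^ j : ℕ) : ℤ)))
    (ρ₃ := GaloisRep.restrictField E (W.torsionGaloisModule ((p ^ (j + 1) : ℕ) : ℤ)))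
    ((Levels.levelMul W p j 1).restrictField E) ((Levels.levelIncl W p j 1).restrictField E)
    ContIntertwiningMap.id (p ^ 1) (fun T => by
      change Levels.levelIncl W p j 1 (Levels.levelMul W p j 1 T) = p ^ 1 • T
      exact Levels.levelIncl_levelMul W p j 1 T) x
  rw [h, map_id_one_apply, pow_one]

/-- The Galois action on `E[n](K̄)|_{Γ_E}` on underlying points: `(σ • P : E(K̄)) = res σ • P`.
[folklore] -/
theorem coe_restrictField_torsionGaloisModule_apply (n : ℤ) (σ : absoluteGaloisGroup E)
    (P : geomTorsion W n) :
    ((GaloisRep.restrictField E (W.torsionGaloisModule n) σ P : geomTorsion W n) : geomPoints W) =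
      absGaloisRestrict K E σ • (P : geomPoints W) := by
  change (((absGaloisRestrict K E σ) • P : geomTorsion W n) : geomPoints W) = _
  rw [Literature.NumberTheory.EllipticCurves.AddSubgroup.torsionBy.coe_smul]

/-- **`ι_* : H¹(E, E[p^j]) → H¹(E, E[p^{j+1}])` is injective when `E[p](K̄)^{Γ_E} = 0`**: if
`ι ∘ ψ = ∂T` with `T ∈ E[p^{j+1}]`, then `p^j T` is a `Γ_E`-fixed point of `E[p]`, hence `0`, so
`T ∈ E[p^j]` and `ψ = ∂T`. [cite: SerreGaloisCohomology1997, I §2.2 and §5.1] -/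
theorem map_levelIncl_injective_of_invariants
    (h0 : ∀ P ∈ (GaloisRep.restrictField E (W.torsionGaloisModule ((p ^ 1 : ℕ) : ℤ))).toTopRep.ρ.invariants,
      P = 0) :
    Function.Injective (galoisCohomology.map ((Levels.levelIncl W p j 1).restrictField E) 1) := by
  refine (injective_iff_map_eq_zero _).mpr fun y hy => ?_
  obtain ⟨ψ, rfl⟩ := oneCocycleClass_surjective
    (DiscreteGaloisModule.toTopRep (GaloisRep.restrictField E (W.torsionGaloisModule ((p ^ j : ℕ) : ℤ)))) y
  rw [galoisCohomology.map_one_oneCocycleClass] at hy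
  obtain ⟨T, hT⟩ := (oneCocycleClass_eq_zero_iff _ _).mp hy
  -- `hT σ : ι (ψ σ) = σ T - T` in `E[p^{j+1}]`; on underlying points:
  have hT' : ∀ σ : absoluteGaloisGroup E,
      ((ψ.1 σ : geomTorsion W ((p ^ j : ℕ) : ℤ)) : geomPoints W) =
        absGaloisRestrict K E σ • (T : geomPoints W) - (T : geomPoints W) := by
    intro σ
    have h := congrArg (fun Q : geomTorsion W ((p ^ (j + 1) : ℕ) : ℤ) => (Q : geomPoints W)) (hT σ)
    rw [← coe_restrictField_torsionGaloisModule_apply W E]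
    exact h
  -- `p^j • T` is a `Γ_E`-fixed element of `E[p]`
  have hpT : ((p ^ j : ℕ) : ℤ) • (T : geomPoints W) ∈ geomTorsion W ((p ^ 1 : ℕ) : ℤ) := by
    rw [mem_geomTorsion_iff, smul_smul, ← Nat.cast_mul, ← pow_add, add_comm]
    exact (mem_geomTorsion_iff W _ _).mp T.2
  have hfix : (⟨_, hpT⟩ : geomTorsion W ((p ^ 1 : ℕ) : ℤ)) ∈
      (GaloisRep.restrictField E (W.torsionGaloisModule ((p ^ 1 : ℕ) : ℤ))).toTopRep.ρ.invariants := by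
    intro σ
    apply Subtype.ext
    change ((GaloisRep.restrictField E (W.torsionGaloisModule ((p ^ 1 : ℕ) : ℤ)) σ ⟨_, hpT⟩ :
        geomTorsion W ((p ^ 1 : ℕ) : ℤ)) : geomPoints W) = ((p ^ j : ℕ) : ℤ) • (T : geomPoints W)
    rw [coe_restrictField_torsionGaloisModule_apply W E]
    change absGaloisRestrict K E σ • (((p ^ j : ℕ) : ℤ) • (T : geomPoints W)) =
      ((p ^ j : ℕ) : ℤ) • (T : geomPoints W)
    rw [smul_zsmul_geomPoints]
    -- `σ(p^j T) - p^j T = p^j (σ T - T) = p^j ψ(σ) = 0`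
    have hψ0 : ((p ^ j : ℕ) : ℤ) • ((ψ.1 σ : geomTorsion W ((p ^ j : ℕ) : ℤ)) : geomPoints W) = 0 :=
      (mem_geomTorsion_iff W _ _).mp (ψ.1 σ).2
    rw [hT', smul_sub, sub_eq_zero] at hψ0
    exact hψ0
  have hpT0 : ((p ^ j : ℕ) : ℤ) • (T : geomPoints W) = 0 :=
    congrArg Subtype.val (h0 _ hfix)
  -- so `T ∈ E[p^j]`, and `ψ = ∂T`
  have hTj : (T : geomPoints W) ∈ geomTorsion W ((p ^ j : ℕ) : ℤ) := (mem_geomTorsion_iff W _ _).mpr hpT0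
  refine (oneCocycleClass_eq_zero_iff _ ψ).mpr ⟨⟨_, hTj⟩, fun σ => Subtype.ext ?_⟩
  change ((ψ.1 σ : geomTorsion W ((p ^ j : ℕ) : ℤ)) : geomPoints W) =
    ((GaloisRep.restrictField E (W.torsionGaloisModule ((p ^ j : ℕ) : ℤ)) σ ⟨_, hTj⟩ - ⟨_, hTj⟩ :
      geomTorsion W ((p ^ j : ℕ) : ℤ)) : geomPoints W)
  rw [AddSubgroup.coe_sub, coe_restrictField_torsionGaloisModule_apply W E, hT']

/-- **`#H¹(E, E[p^{j+1}])[p] ≤ #H¹(E, E[p])` when `E[p](K̄)^{Γ_E} = 0`** (and `H¹(E, E[p])` is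
finite): a class killed by `p` is killed by `π_*` (`p = ι_* ∘ π_*`, `ι_*` injective), hence comes
from `H¹(E, E[p])` by the exactness of `H¹(E, E[p]) → H¹(E, E[p^{j+1}]) →(π_*) H¹(E, E[p^j])`.
[cite: SerreGaloisCohomology1997, I §2.2] [cite: MilneADT2006, Ch. I §6, proof of Prop. 6.9] -/
theorem natCard_ker_nsmul_galoisCohomology_le [W.IsElliptic] [Fact p.Prime]
    (h0 : ∀ P ∈ (GaloisRep.restrictField E (W.torsionGaloisModule ((p ^ 1 : ℕ) : ℤ))).toTopRep.ρ.invariants,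
      P = 0)
    [Finite (galoisCohomology (GaloisRep.restrictField E (W.torsionGaloisModule ((p ^ 1 : ℕ) : ℤ))) 1)] :
    Nat.card (nsmulAddMonoidHom p : galoisCohomology
        (GaloisRep.restrictField E (W.torsionGaloisModule ((p ^ (j + 1) : ℕ) : ℤ))) 1 →+ _).ker ≤
      Nat.card (galoisCohomology (GaloisRep.restrictField E (W.torsionGaloisModule ((p ^ 1 : ℕ) : ℤ))) 1) := by
  have hSES := (isSES_torsionInclusion_levelMul W p j).restrictField E
  have hinj := map_levelIncl_injective_of_invariants W E p j h0
  -- every element of the kernel lifts to `H¹(E, E[p])`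
  have hlift : ∀ x : (nsmulAddMonoidHom p : galoisCohomology
      (GaloisRep.restrictField E (W.torsionGaloisModule ((p ^ (j + 1) : ℕ) : ℤ))) 1 →+ _).ker,
      ∃ y : galoisCohomology (GaloisRep.restrictField E (W.torsionGaloisModule ((p ^ 1 : ℕ) : ℤ))) 1,
        galoisCohomology.map ((W.torsionInclusion (natCast_dvd_natCast_pow_succ p j)).restrictField E) 1 y
          = x.1 := by
    intro x
    have hx : p • x.1 = 0 := x.2
    rw [nsmul_eq_map_levelIncl_map_levelMul W E p j] at hx
    have hπ : galoisCohomology.map ((Levels.levelMul W p j 1).restrictField E) 1 x.1 = 0 :=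
      hinj (by rw [hx, map_zero])
    exact hSES.exists_map_one_eq_of_map_one_eq_zero x.1 hπ
  choose lift hlift using hlift
  refine Nat.card_le_card_of_injective lift fun a b hab => ?_
  apply Subtype.ext
  rw [← hlift a, ← hlift b, hab]

end Levels

end Summit.BirchSwinnertonDyer.Rank1Residual.Additive.SignedTwist

end
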